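import Mathlib
import Literature.Analysis.PDE.SingleEntropy.Potential
import HarnessLib

/-!
# The potential is a viscosity subsolution of `hₜ + f(hₓ) = 0` (DLOW §4.1)

Topic `Literature/Analysis/PDE/SingleEntropy` — part of the formalization of
De Lellis–Otto–Westdickenberg, *Minimal entropy conditions for Burgers equation*, Quart. Appl.
Math. 62 (2004) 687–700, Thm 2.3 / Cor 2.5 (the named fact
`Literature.Analysis.PDE.deLellisOttoWestdickenberg_singleEntropy`).

`viscosity_subsolution`: if `h` is bounded Lipschitz with a.e. gradient `(-f(u), u)` on an open
`V` and `f` is convex, then at every local maximum `z₀ ∈ V` of `h - ζ` with `ζ` of class `C¹` near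
`z₀` one has `ζₜ(z₀) + f(ζₓ(z₀)) ≤ 0`. As in §4.1 of the paper: the mollifications `ρ̄ ⋆ h` are
classical subsolutions by Jensen's inequality (`mollify_subsolution`), and the subsolution
property passes to uniform limits (strict-maximum perturbation).
[cite: DelellisOttoWestdickenberg2004, §4.1]
-/

noncomputable section

open MeasureTheory Set Filter Metric ContinuousLinearMap
open scoped Topology Convolution NNReal

namespace Literature.Analysis.PDE.SingleEntropy

variable (ρ : ContDiffBump (0 : ℝ × ℝ))

/-! ## The potential is a viscosity subsolution of `hₜ + f(hₓ) = 0` (DLOW §4.1) -/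

section Subsolution

open scoped NNReal

/-- Derivative of the mollification of a bounded Lipschitz function. [folklore] -/
theorem fderiv_mollify_lipschitz_of_bound {ψ : ℝ × ℝ → ℝ} {L : ℝ≥0} (hψ : LipschitzWith L ψ)
    {Mψ : ℝ} (hM : ∀ z, |ψ z| ≤ Mψ) (p v : ℝ × ℝ) :
    fderiv ℝ (ρ.normed volume ⋆[lsmul ℝ ℝ, volume] ψ) p v
      = ∫ y, ρ.normed volume (p - y) * lineDeriv ℝ ψ y v := by
  rw [fderiv_mollify_apply ρ hψ.continuous.measurable hM p v]
  obtain ⟨D, hD⟩ := ContDiff.lipschitzWith_of_hasCompactSupport (hasCompactSupport_reflect ρ p)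
    (contDiff_reflect ρ p) (by simp)
  have key := hψ.integral_lineDeriv_mul_eq (μ := volume) hD (hasCompactSupport_reflect ρ p) v
  simp_rw [lineDeriv_reflect_neg] at key
  calc ∫ y, fderiv ℝ (ρ.normed volume) (p - y) v * ψ y
      = ∫ y, lineDeriv ℝ ψ y v * ρ.normed volume (p - y) := key.symm
    _ = ∫ y, ρ.normed volume (p - y) * lineDeriv ℝ ψ y v := by
        congr 1; funext y; ring

/-- **Gradient of the mollified potential.** If a bounded Lipschitz `h` has a.e. gradient
`(G₁, G₂)` (bounded measurable) on `V ⊇ closedBall p rOut`, then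
`∂ᵥ(ρ̄ ⋆ h)(p) = (ρ̄ ⋆ Gᵥ)(p)` for `v = (1,0), (0,1)`. [folklore] -/
theorem fderiv_mollify_potential {h : ℝ × ℝ → ℝ} {L : ℝ≥0} (hh : LipschitzWith L h)
    {Mh : ℝ} (hMh : ∀ z, |h z| ≤ Mh) {V : Set (ℝ × ℝ)} {G₁ G₂ : ℝ × ℝ → ℝ}
    (hae : ∀ᵐ z ∂(volume : Measure (ℝ × ℝ)), z ∈ V →
      DifferentiableAt ℝ h z ∧ fderiv ℝ h z (1, 0) = G₁ z ∧ fderiv ℝ h z (0, 1) = G₂ z)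
    {p : ℝ × ℝ} (hp : closedBall p ρ.rOut ⊆ V) :
    fderiv ℝ (ρ.normed volume ⋆[lsmul ℝ ℝ, volume] h) p (1, 0)
        = (ρ.normed volume ⋆[lsmul ℝ ℝ, volume] G₁) p ∧
      fderiv ℝ (ρ.normed volume ⋆[lsmul ℝ ℝ, volume] h) p (0, 1)
        = (ρ.normed volume ⋆[lsmul ℝ ℝ, volume] G₂) p := by
  have key : ∀ (v : ℝ × ℝ) (G : ℝ × ℝ → ℝ),
      (∀ᵐ z ∂(volume : Measure (ℝ × ℝ)), z ∈ V → DifferentiableAt ℝ h z ∧ fderiv ℝ h z v = G z) →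
      fderiv ℝ (ρ.normed volume ⋆[lsmul ℝ ℝ, volume] h) p v
        = (ρ.normed volume ⋆[lsmul ℝ ℝ, volume] G) p := by
    intro v G hG
    rw [fderiv_mollify_lipschitz_of_bound ρ hh hMh, mollify_apply]
    apply integral_congr_ae
    filter_upwards [hG] with y hy
    by_cases hyV : y ∈ V
    · obtain ⟨hd, he⟩ := hy hyV
      rw [hd.lineDeriv_eq_fderiv, he]
    · have : y ∉ ball p ρ.rOut := fun h' => hyV (hp (ball_subset_closedBall h'))
      simp [reflect_eq_zero ρ this]
  refine ⟨key (1, 0) G₁ ?_, key (0, 1) G₂ ?_⟩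
  · filter_upwards [hae] with z hz hzV using ⟨(hz hzV).1, (hz hzV).2.1⟩
  · filter_upwards [hae] with z hz hzV using ⟨(hz hzV).1, (hz hzV).2.2⟩

/-- **Mollified potentials are classical subsolutions** (Jensen): if `∇h = (-f(u), u)` a.e. on
`V` with `f` convex, then `∂ₜ(ρ̄ ⋆ h) + f(∂ₓ(ρ̄ ⋆ h)) ≤ 0` at every `p` with
`closedBall p rOut ⊆ V`. (De Lellis–Otto–Westdickenberg 2004, §4.1.) [folklore] -/
theorem mollify_subsolution {f : ℝ → ℝ} (hf : ContDiff ℝ 2 f) (hfc : ∀ w, 0 ≤ deriv (deriv f) w)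
    {u : ℝ × ℝ → ℝ} (hu : Measurable u) {M : ℝ} (huM : ∀ p, |u p| ≤ M)
    {h : ℝ × ℝ → ℝ} {L : ℝ≥0} (hh : LipschitzWith L h) {Mh : ℝ} (hMh : ∀ z, |h z| ≤ Mh)
    {V : Set (ℝ × ℝ)}
    (hae : ∀ᵐ z ∂(volume : Measure (ℝ × ℝ)), z ∈ V →
      DifferentiableAt ℝ h z ∧ fderiv ℝ h z (1, 0) = -f (u z) ∧ fderiv ℝ h z (0, 1) = u z)
    {p : ℝ × ℝ} (hp : closedBall p ρ.rOut ⊆ V) :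
    fderiv ℝ (ρ.normed volume ⋆[lsmul ℝ ℝ, volume] h) p (1, 0)
      + f (fderiv ℝ (ρ.normed volume ⋆[lsmul ℝ ℝ, volume] h) p (0, 1)) ≤ 0 := by
  obtain ⟨e1, e2⟩ := fderiv_mollify_potential ρ hh hMh hae hp
  rw [e1, e2, mollify_neg]
  have := comp_mollify_le ρ hf hfc hu huM p
  linarith

/-- **The potential is a viscosity subsolution** (De Lellis–Otto–Westdickenberg 2004, §4.1):
at a local maximum `z₀ ∈ V` of `h - ζ` with `ζ` of class `C¹` near `z₀`,
`ζₜ(z₀) + f(ζₓ(z₀)) ≤ 0`. Proof: the mollifications `ρ̄ ⋆ h` are classical subsolutions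
(`mollify_subsolution`) converging uniformly to `h`; perturb to a strict maximum and use the
stability of maxima. [cite: DelellisOttoWestdickenberg2004, §4.1] -/
theorem viscosity_subsolution {f : ℝ → ℝ} (hf : ContDiff ℝ 2 f)
    (hfc : ∀ w, 0 ≤ deriv (deriv f) w)
    {u : ℝ × ℝ → ℝ} (hu : Measurable u) {M : ℝ} (huM : ∀ p, |u p| ≤ M)
    {h : ℝ × ℝ → ℝ} {L : ℝ≥0} (hh : LipschitzWith L h) {Mh : ℝ} (hMh : ∀ z, |h z| ≤ Mh)
    {V : Set (ℝ × ℝ)} (hV : IsOpen V)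
    (hae : ∀ᵐ z ∂(volume : Measure (ℝ × ℝ)), z ∈ V →
      DifferentiableAt ℝ h z ∧ fderiv ℝ h z (1, 0) = -f (u z) ∧ fderiv ℝ h z (0, 1) = u z)
    {z₀ : ℝ × ℝ} (hz₀ : z₀ ∈ V) {ζ : ℝ × ℝ → ℝ} (hζ : ContDiffAt ℝ 1 ζ z₀)
    (hmax : IsLocalMax (fun z => h z - ζ z) z₀) :
    fderiv ℝ ζ z₀ (1, 0) + f (fderiv ℝ ζ z₀ (0, 1)) ≤ 0 := by
  -- the quadratic perturbation
  set q : ℝ × ℝ → ℝ := fun z => (z.1 - z₀.1) ^ 2 + (z.2 - z₀.2) ^ 2 with hq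
  have hqs : ContDiff ℝ (⊤ : ℕ∞) q := by simp only [hq]; fun_prop
  have hq1 : Differentiable ℝ q := hqs.differentiable (by simp)
  have hq0 : q z₀ = 0 := by simp [hq]
  have hqd0 : fderiv ℝ q z₀ = 0 := by
    have hmin : IsLocalMin q z₀ :=
      Filter.Eventually.of_forall fun z => by
        show q z₀ ≤ q z
        rw [hq0]
        simp only [hq]
        positivity
    exact hmin.hasFDerivAt_eq_zero (hq1 z₀).hasFDerivAt
  have hqlow : ∀ z, (dist z z₀) ^ 2 ≤ q z := by
    intro z
    rw [Prod.dist_eq, Real.dist_eq, Real.dist_eq]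
    simp only [hq]
    rcases le_total |z.1 - z₀.1| |z.2 - z₀.2| with hle | hle
    · rw [max_eq_right hle]; nlinarith [sq_abs (z.2 - z₀.2), sq_nonneg (z.1 - z₀.1)]
    · rw [max_eq_left hle]; nlinarith [sq_abs (z.1 - z₀.1), sq_nonneg (z.2 - z₀.2)]
  -- a radius where everything is controlled
  have hζev := hζ.eventually (by simp)
  obtain ⟨r₁, hr₁, hζr⟩ : ∃ r₁ > 0, ∀ y ∈ ball z₀ r₁, ContDiffAt ℝ 1 ζ y :=
    Metric.eventually_nhds_iff_ball.mp hζev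
  obtain ⟨r₂, hr₂, hmaxr⟩ : ∃ r₂ > 0, ∀ y ∈ ball z₀ r₂, h y - ζ y ≤ h z₀ - ζ z₀ :=
    Metric.eventually_nhds_iff_ball.mp hmax
  obtain ⟨r₃, hr₃, hVr⟩ : ∃ r₃ > 0, ball z₀ r₃ ⊆ V := Metric.isOpen_iff.mp hV z₀ hz₀
  set r : ℝ := min (min r₁ r₂) r₃ / 2 with hr
  have hr0 : 0 < r := by positivity
  have hrr₁ : 2 * r ≤ r₁ := by
    simp only [hr]; nlinarith [min_le_left (min r₁ r₂) r₃, min_le_left r₁ r₂]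
  have hrr₂ : 2 * r ≤ r₂ := by
    simp only [hr]; nlinarith [min_le_left (min r₁ r₂) r₃, min_le_right r₁ r₂]
  have hrr₃ : 2 * r ≤ r₃ := by
    simp only [hr]; nlinarith [min_le_right (min r₁ r₂) r₃]
  have hζc : ∀ y ∈ closedBall z₀ r, ContDiffAt ℝ 1 ζ y := fun y hy =>
    hζr y (closedBall_subset_ball (by linarith) hy)
  have hζd : ∀ y ∈ closedBall z₀ r, DifferentiableAt ℝ ζ y := fun y hy =>
    (hζc y hy).differentiableAt (by simp)
  -- uniform closeness of the mollifications
  have hclose : ∀ (β : ContDiffBump (0 : ℝ × ℝ)) (z : ℝ × ℝ),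
      |(β.normed volume ⋆[lsmul ℝ ℝ, volume] h) z - h z| ≤ L * β.rOut := by
    intro β z
    have := ContDiffBump.dist_normed_convolution_le (μ := volume) (φ := β)
      hh.continuous.aestronglyMeasurable (x₀ := z) (ε := L * β.rOut) (fun y hy => by
        calc dist (h y) (h z) ≤ L * dist y z := hh.dist_le_mul y z
          _ ≤ L * β.rOut := mul_le_mul_of_nonneg_left (mem_ball.mp hy).le L.2)
    rwa [Real.dist_eq] at this
  -- Main estimate: for every `0 < s ≤ r` the inequality holds up to continuity errors at a
  -- point of `ball z₀ s`.
  have main : ∀ s : ℝ, 0 < s → s ≤ r → ∃ z ∈ ball z₀ s,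
      fderiv ℝ ζ z (1, 0) + fderiv ℝ q z (1, 0)
        + f (fderiv ℝ ζ z (0, 1) + fderiv ℝ q z (0, 1)) ≤ 0 := by
    intro s hs hsr
    -- choose the mollification radius
    set ε : ℝ := min (s / 2) (s ^ 2 / (8 * ((L : ℝ) + 1))) with hε
    have hε0 : 0 < ε := by positivity
    have hεs : ε ≤ s / 2 := min_le_left _ _
    have hεL : (L : ℝ) * ε < s ^ 2 / 4 := by
      have h1 : ε ≤ s ^ 2 / (8 * ((L : ℝ) + 1)) := min_le_right _ _
      have hL0 : (0 : ℝ) ≤ L := L.2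
      have h2 : (L : ℝ) * (s ^ 2 / (8 * ((L : ℝ) + 1))) ≤ s ^ 2 / 8 := by
        rw [show (L : ℝ) * (s ^ 2 / (8 * ((L : ℝ) + 1))) = ((L : ℝ) / ((L : ℝ) + 1)) * (s ^ 2 / 8)
          by field_simp]
        exact mul_le_of_le_one_left (by positivity) ((div_le_one (by positivity)).mpr (by linarith))
      calc (L : ℝ) * ε ≤ (L : ℝ) * (s ^ 2 / (8 * ((L : ℝ) + 1))) :=
            mul_le_mul_of_nonneg_left h1 hL0
        _ ≤ s ^ 2 / 8 := h2
        _ < s ^ 2 / 4 := by nlinarith [sq_nonneg s, hs]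
    let β : ContDiffBump (0 : ℝ × ℝ) := ⟨ε / 2, ε, by positivity, by linarith⟩
    have hβ : β.rOut = ε := rfl
    set hε' : ℝ × ℝ → ℝ := β.normed volume ⋆[lsmul ℝ ℝ, volume] h with hhε
    have hεs' : ContDiff ℝ (⊤ : ℕ∞) hε' := contDiff_mollify β hh.continuous.measurable hMh
    have hεd : Differentiable ℝ hε' := hεs'.differentiable (by simp)
    -- the perturbed function and its maximum on the closed ball
    set Φ : ℝ × ℝ → ℝ := fun z => hε' z - ζ z - q z with hΦ
    have hΦc : ContinuousOn Φ (closedBall z₀ r) := by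
      apply ContinuousOn.sub (ContinuousOn.sub hεs'.continuous.continuousOn ?_)
        hqs.continuous.continuousOn
      exact fun y hy => (hζc y hy).continuousAt.continuousWithinAt
    obtain ⟨zm, hzm, hmaxΦ⟩ := (isCompact_closedBall z₀ r).exists_isMaxOn
      ⟨z₀, mem_closedBall_self hr0.le⟩ hΦc
    -- the maximum point lies in `ball z₀ s`
    have hzm_in : zm ∈ ball z₀ s := by
      by_contra hout
      have hd : s ≤ dist zm z₀ := le_of_not_gt (fun h' => hout (mem_ball.mpr h'))
      have h1 : Φ z₀ ≤ Φ zm := hmaxΦ (mem_closedBall_self hr0.le)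
      have h2 : Φ z₀ ≥ h z₀ - ζ z₀ - (L : ℝ) * ε := by
        simp only [hΦ, hq0, sub_zero]
        have := hclose β z₀
        rw [hβ] at this
        have := abs_le.mp this
        simp only [hhε]; linarith [this.1]
      have h3 : Φ zm ≤ h z₀ - ζ z₀ + (L : ℝ) * ε - s ^ 2 := by
        simp only [hΦ]
        have c1 := abs_le.mp (hβ ▸ hclose β zm)
        have c2 : h zm - ζ zm ≤ h z₀ - ζ z₀ :=
          hmaxr zm (closedBall_subset_ball (by linarith) hzm)
        have c3 : s ^ 2 ≤ q zm := le_trans (by nlinarith [hd, dist_nonneg (x := zm) (y := z₀)])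
          (hqlow zm)
        simp only [hhε] at c1 ⊢
        linarith [c1.2]
      nlinarith
    -- it is a local maximum of a function differentiable there
    have hzm_r : zm ∈ ball z₀ r := ball_subset_ball (by linarith) hzm_in
    have hloc : IsLocalMax Φ zm :=
      hmaxΦ.isLocalMax (closedBall_mem_nhds_of_mem hzm_r)
    have hζzm : DifferentiableAt ℝ ζ zm := hζd zm hzm
    have hΦd : HasFDerivAt Φ (fderiv ℝ hε' zm - fderiv ℝ ζ zm - fderiv ℝ q zm) zm :=
      ((hεd zm).hasFDerivAt.sub hζzm.hasFDerivAt).sub (hq1 zm).hasFDerivAt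
    have hzero := hloc.hasFDerivAt_eq_zero hΦd
    have hgt : fderiv ℝ hε' zm (1, 0) = fderiv ℝ ζ zm (1, 0) + fderiv ℝ q zm (1, 0) := by
      have := congrArg (fun A : ℝ × ℝ →L[ℝ] ℝ => A (1, 0)) hzero
      simp only [_root_.sub_apply, _root_.zero_apply] at this
      linarith
    have hgx : fderiv ℝ hε' zm (0, 1) = fderiv ℝ ζ zm (0, 1) + fderiv ℝ q zm (0, 1) := by
      have := congrArg (fun A : ℝ × ℝ →L[ℝ] ℝ => A (0, 1)) hzero
      simp only [_root_.sub_apply, _root_.zero_apply] at this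
      linarith
    -- the classical subsolution inequality at `zm`
    have hball : closedBall zm β.rOut ⊆ V := by
      refine subset_trans (fun y hy => ?_) hVr
      rw [mem_closedBall] at hy
      rw [mem_ball]
      have := mem_ball.mp hzm_in
      calc dist y z₀ ≤ dist y zm + dist zm z₀ := dist_triangle _ _ _
        _ < r₃ := by rw [hβ] at hy; linarith
    have hsub := mollify_subsolution β hf hfc hu huM hh hMh hae hball
    refine ⟨zm, hzm_in, ?_⟩
    simp only [hhε] at hgt hgx
    rw [← hgt, ← hgx]
    exact hsub
  -- pass to the limit `s → 0`
  have hcontζ : ContinuousAt (fderiv ℝ ζ) z₀ := hζ.continuousAt_fderiv (by simp)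
  have hcontq : Continuous (fderiv ℝ q) := hqs.continuous_fderiv (by simp)
  choose! zs hzs hineq using main
  have hzlim : Tendsto (fun n : ℕ => zs (r / ((n : ℝ) + 1))) atTop (𝓝 z₀) := by
    rw [Metric.tendsto_atTop]
    intro δ hδ
    obtain ⟨N, hN⟩ := exists_nat_gt (r / δ)
    refine ⟨N, fun n hn => ?_⟩
    have hn' : (N : ℝ) ≤ n := by exact_mod_cast hn
    have hpos : 0 < r / ((n : ℝ) + 1) := by positivity
    have hle : r / ((n : ℝ) + 1) ≤ r := div_le_self hr0.le (by linarith)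
    have := mem_ball.mp (hzs _ hpos hle)
    calc dist (zs (r / ((n : ℝ) + 1))) z₀ < r / ((n : ℝ) + 1) := this
      _ < δ := by
        rw [div_lt_iff₀ (by positivity)]
        have h1 : r / δ < (n : ℝ) + 1 := by linarith
        rw [div_lt_iff₀ hδ] at h1
        linarith
  have lim : Tendsto (fun n : ℕ =>
      fderiv ℝ ζ (zs (r / ((n : ℝ) + 1))) (1, 0) + fderiv ℝ q (zs (r / ((n : ℝ) + 1))) (1, 0)
        + f (fderiv ℝ ζ (zs (r / ((n : ℝ) + 1))) (0, 1)
          + fderiv ℝ q (zs (r / ((n : ℝ) + 1))) (0, 1))) atTop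
      (𝓝 (fderiv ℝ ζ z₀ (1, 0) + fderiv ℝ q z₀ (1, 0)
        + f (fderiv ℝ ζ z₀ (0, 1) + fderiv ℝ q z₀ (0, 1)))) := by
    have tζ : Tendsto (fun n : ℕ => fderiv ℝ ζ (zs (r / ((n : ℝ) + 1)))) atTop
        (𝓝 (fderiv ℝ ζ z₀)) := hcontζ.tendsto.comp hzlim
    have tq : Tendsto (fun n : ℕ => fderiv ℝ q (zs (r / ((n : ℝ) + 1)))) atTop
        (𝓝 (fderiv ℝ q z₀)) := (hcontq.tendsto z₀).comp hzlim
    have ev : ∀ v : ℝ × ℝ, Tendsto (fun n : ℕ => fderiv ℝ ζ (zs (r / ((n : ℝ) + 1))) v) atTop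
        (𝓝 (fderiv ℝ ζ z₀ v)) := fun v => by
      have := ((ContinuousLinearMap.apply ℝ ℝ v).continuous.tendsto _).comp tζ
      refine (this.congr (fun n => ?_)).trans (by simp)
      simp [Function.comp_apply]
    have eqv : ∀ v : ℝ × ℝ, Tendsto (fun n : ℕ => fderiv ℝ q (zs (r / ((n : ℝ) + 1))) v) atTop
        (𝓝 (fderiv ℝ q z₀ v)) := fun v => by
      have := ((ContinuousLinearMap.apply ℝ ℝ v).continuous.tendsto _).comp tq
      refine (this.congr (fun n => ?_)).trans (by simp)
      simp [Function.comp_apply]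
    exact ((ev (1, 0)).add (eqv (1, 0))).add
      ((hf.continuous.tendsto _).comp ((ev (0, 1)).add (eqv (0, 1))))
  have hfin := le_of_tendsto' lim (fun n => hineq _ (by positivity)
    (div_le_self hr0.le (by linarith)))
  rw [hqd0] at hfin
  simpa using hfin

end Subsolution

end Literature.Analysis.PDE.SingleEntropy
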